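import Literature.Probability.RandomPlanarGeometry.SAWCount
import HarnessLib

/-!
# Bridges and half-space walks on `ℤ^d` (Madras–Slade §1.2, §3.1)

Topic `Literature/Probability/RandomPlanarGeometry` (continues `SAWCount.lean`: the function model
`saws d n` of `n`-step self-avoiding walks from `0`, `#saws d n = cₙ`). Source: N. Madras,
G. Slade, *The Self-Avoiding Walk* (1993), Definition 1.2.4 and eq. (1.2.15) (bridges),
Definition 3.1.2 (half-space walks) and the proof of Theorem 3.1.1 (Hammersley–Welsh), first
line of (3.1.7). "First coordinate" `ω₁` is the coordinate `0 : Fin d` (`d ≥ 1`, `[NeZero d]`).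

## Contents (namespace `Literature.SAW.Zd`; all PROVED, no named facts)

* `IsBridge n ω` (`ω₁(0) < ω₁(i) ≤ ω₁(n)`, `1 ≤ i ≤ n`), `IsHalfSpace n ω` (`ω₁(0) < ω₁(i)`),
  the finsets `bridges d n ⊆ halfSpaceWalks d n ⊆ saws d n` and the counts
  `bridgeCount d n = bₙ`, `halfSpaceCount d n = hₙ` (`b₀ = h₀ = 1`), with
  `bₙ ≤ cₙ`, `hₙ ≤ cₙ`, `1 ≤ bₙ`;
* `concatWalk`, `concatWalk_mem_saws` and **`bridgeCount_mul_le : b_m b_n ≤ b_{m+n}`**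
  (Madras–Slade (1.2.15): "the concatenation of two bridges will always yield another bridge");
* `firstMin`, `lastMin`, `tailWalk`, `headWalk` and
  **`count_le_sum_halfSpaceCount : cₙ ≤ Σ_{m=0}^{n} h_{m+1} h_{n-m}`** (Madras–Slade, proof of
  Theorem 3.1.1, first line of (3.1.7): cut at the last minimum `m` of `ω₁`; the tail is a
  half-space walk, the head reversed and preceded by a step `-e₁` is a half-space walk, and the
  decomposition is injective).

The unfolding of half-space walks into bridges (Proposition 3.1.5) and `μ_Bridge = μ`
(Corollary 3.1.6) are in `SAWUnfolding.lean`.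
-/

noncomputable section

open Filter Topology Literature.Probability.LatticeModels Literature.Probability.Percolation SimpleGraph
open scoped BigOperators

namespace Literature.Probability.RandomPlanarGeometry.SAW.Zd

/-! ## Bridges and half-space walks (Madras–Slade §1.2, §3.1) -/

section Bridges

variable {d : ℕ} [NeZero d]

/-- **Bridge** (Madras–Slade Definition 1.2.4): an `n`-step walk `ω` (as a vertex function) is a
bridge if `ω₁(0) < ω₁(i) ≤ ω₁(n)` for `1 ≤ i ≤ n` (first coordinate = coordinate `0`).
[cite: MadrasSlade1993, Definition 1.2.4] -/
def IsBridge (n : ℕ) (ω : ℕ → Site d) : Prop :=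
  ∀ i, 1 ≤ i → i ≤ n → ω 0 0 < ω i 0 ∧ ω i 0 ≤ ω n 0

/-- **Half-space walk** (Madras–Slade Definition 3.1.2): `ω₁(0) < ω₁(i)` for `1 ≤ i ≤ n`.
[cite: MadrasSlade1993, Definition 3.1.2] -/
def IsHalfSpace (n : ℕ) (ω : ℕ → Site d) : Prop :=
  ∀ i, 1 ≤ i → i ≤ n → ω 0 0 < ω i 0

/-- A bridge is a half-space walk. [cite: MadrasSlade1993, §3.1] -/
theorem IsBridge.isHalfSpace {n : ℕ} {ω : ℕ → Site d} (h : IsBridge n ω) : IsHalfSpace n ω :=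
  fun i h1 h2 => (h i h1 h2).1

open Classical in
/-- The `n`-step bridges from the origin. [cite: MadrasSlade1993, Definition 1.2.4] -/
def bridges (d : ℕ) [NeZero d] (n : ℕ) : Finset (ℕ → Site d) :=
  (saws d n).filter (IsBridge n)

/-- `b_n`, the number of `n`-step bridges from the origin (`b₀ = 1`).
[cite: MadrasSlade1993, Definition 1.2.4] -/
def bridgeCount (d : ℕ) [NeZero d] (n : ℕ) : ℕ :=
  (bridges d n).card

open Classical in
/-- The `n`-step half-space walks from the origin. [cite: MadrasSlade1993, Definition 3.1.2] -/
def halfSpaceWalks (d : ℕ) [NeZero d] (n : ℕ) : Finset (ℕ → Site d) :=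
  (saws d n).filter (IsHalfSpace n)

/-- `h_n`, the number of `n`-step half-space walks from the origin (`h₀ = 1`).
[cite: MadrasSlade1993, Definition 3.1.2] -/
def halfSpaceCount (d : ℕ) [NeZero d] (n : ℕ) : ℕ :=
  (halfSpaceWalks d n).card

/-- Membership in `bridges`. [cite: MadrasSlade1993, Definition 1.2.4] -/
theorem mem_bridges {n : ℕ} {ω : ℕ → Site d} : ω ∈ bridges d n ↔ ω ∈ saws d n ∧ IsBridge n ω := by
  classical
  exact Finset.mem_filter

/-- Membership in `halfSpaceWalks`. [cite: MadrasSlade1993, Definition 3.1.2] -/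
theorem mem_halfSpaceWalks {n : ℕ} {ω : ℕ → Site d} :
    ω ∈ halfSpaceWalks d n ↔ ω ∈ saws d n ∧ IsHalfSpace n ω := by
  classical
  exact Finset.mem_filter

/-- `b_n ≤ c_n`. [cite: MadrasSlade1993, §1.2] -/
theorem bridgeCount_le_count (n : ℕ) : bridgeCount d n ≤ count d n := by
  classical
  rw [bridgeCount, bridges, ← card_saws]
  exact Finset.card_filter_le _ _

/-- Bridges are half-space walks: `b_n ≤ h_n`. [cite: MadrasSlade1993, §3.1] -/
theorem bridges_subset_halfSpaceWalks (n : ℕ) : bridges d n ⊆ halfSpaceWalks d n := by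
  intro ω hω
  rw [mem_bridges] at hω
  exact mem_halfSpaceWalks.2 ⟨hω.1, hω.2.isHalfSpace⟩

/-- `h_n ≤ c_n`. [cite: MadrasSlade1993, §3.1] -/
theorem halfSpaceCount_le_count (n : ℕ) : halfSpaceCount d n ≤ count d n := by
  classical
  rw [halfSpaceCount, halfSpaceWalks, ← card_saws]
  exact Finset.card_filter_le _ _

/-- The straight walk is a bridge: `b_n ≥ 1`. [cite: MadrasSlade1993, §1.2] -/
theorem one_le_bridgeCount (n : ℕ) : 1 ≤ bridgeCount d n := by
  refine Finset.card_pos.2 ⟨straightWalk d n, mem_bridges.2 ⟨straightWalk_mem_saws d n, ?_⟩⟩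
  intro i h1 h2
  simp only [straightWalk, Pi.single_eq_same, min_eq_left h2, min_self, Nat.zero_min, Nat.cast_zero]
  exact ⟨by exact_mod_cast h1, by exact_mod_cast h2⟩

/-! ### Concatenation: `b_m b_n ≤ b_{m+n}` (Madras–Slade (1.2.15)) -/

/-- Concatenation of an `m`-step walk with (the translate of) a second walk. [cite: MadrasSlade1993, §1.2] -/
def concatWalk (m : ℕ) (ω υ : ℕ → Site d) : ℕ → Site d :=
  fun i => if i ≤ m then ω i else ω m + υ (i - m)

omit [NeZero d] in
/-- The concatenation of two self-avoiding walks whose pieces are separated is self-avoiding;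
here: general bookkeeping, separation supplied as a hypothesis. [cite: MadrasSlade1993, §1.2] -/
theorem concatWalk_mem_saws {m n : ℕ} {ω υ : ℕ → Site d} (hω : ω ∈ saws d m) (hυ : υ ∈ saws d n)
    (hsep : ∀ i ≤ m, ∀ j, 1 ≤ j → j ≤ n → ω i ≠ ω m + υ j) :
    concatWalk m ω υ ∈ saws d (m + n) := by
  obtain ⟨hω0, hωend, hωadj, hωinj⟩ := mem_saws.1 hω
  obtain ⟨hυ0, hυend, hυadj, hυinj⟩ := mem_saws.1 hυ
  refine mem_saws.2 ⟨by simp [concatWalk, hω0], ?_, ?_, ?_⟩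
  · intro i hi
    have h1 : ¬ i ≤ m ∨ n = 0 := by omega
    rcases h1 with h1 | rfl
    · have h2 : ¬ m + n ≤ m ∨ n = 0 := by omega
      rcases h2 with h2 | rfl
      · simp only [concatWalk, if_neg h1, if_neg h2, Nat.add_sub_cancel_left]
        rw [hυend (i - m) (by omega)]
      · simp only [concatWalk, if_neg h1, add_zero, if_pos le_rfl]
        rw [hυend (i - m) (by omega), ← hυend 0 le_rfl, hυ0, add_zero]
    · simp only [add_zero] at hi ⊢
      simp only [concatWalk, if_pos le_rfl]
      by_cases h : i ≤ m
      · rw [if_pos h, hωend i hi]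
      · rw [if_neg h, hυend (i - m) (by omega), ← hυend 0 le_rfl, hυ0, add_zero]
  · intro i hi
    by_cases h : i + 1 ≤ m
    · simp only [concatWalk, if_pos h, if_pos (Nat.le_of_succ_le h)]
      exact hωadj i h
    · by_cases h' : i ≤ m
      · have him : i = m := by omega
        subst him
        simp only [concatWalk, if_pos le_rfl, if_neg h, Nat.add_sub_cancel_left]
        have := (zdGraph_adj_add_right (υ 0) (υ 1) (ω i)).2 (hυadj 0 (by omega))
        rwa [hυ0, zero_add, add_comm] at this
      · simp only [concatWalk, if_neg h, if_neg h']
        rw [show i + 1 - m = (i - m) + 1 by omega, add_comm (ω m) (υ (i - m)),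
          add_comm (ω m), zdGraph_adj_add_right]
        exact hυadj (i - m) (by omega)
  · intro i hi j hj hij
    simp only [Set.mem_setOf_eq] at hi hj
    simp only [concatWalk] at hij
    by_cases h1 : i ≤ m <;> by_cases h2 : j ≤ m
    · rw [if_pos h1, if_pos h2] at hij
      exact hωinj (show i ≤ m from h1) (show j ≤ m from h2) hij
    · rw [if_pos h1, if_neg h2] at hij
      exact absurd hij (hsep i h1 (j - m) (by omega) (by omega))
    · rw [if_neg h1, if_pos h2] at hij
      exact absurd hij.symm (hsep j h2 (i - m) (by omega) (by omega))
    · rw [if_neg h1, if_neg h2, add_right_inj] at hij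
      have := hυinj (show i - m ≤ n by omega) (show j - m ≤ n by omega) hij
      omega

/-- **`b_m · b_n ≤ b_{m+n}`**: "The concatenation of two bridges will always yield another bridge".
[cite: MadrasSlade1993, §1.2, eq. (1.2.15)] -/
theorem bridgeCount_mul_le (m n : ℕ) :
    bridgeCount d m * bridgeCount d n ≤ bridgeCount d (m + n) := by
  rw [bridgeCount, bridgeCount, bridgeCount, ← Finset.card_product]
  refine Finset.card_le_card_of_injOn (fun p => concatWalk m p.1 p.2) ?_ ?_
  · rintro ⟨ω, υ⟩ hp
    simp only [Finset.mem_coe, Finset.mem_product, mem_bridges] at hp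
    obtain ⟨⟨hω, hωb⟩, hυ, hυb⟩ := hp
    show concatWalk m ω υ ∈ (bridges d (m + n) : Set (ℕ → Site d))
    rw [Finset.mem_coe, mem_bridges]
    have hω0 := (mem_saws.1 hω).1
    have hυ0 := (mem_saws.1 hυ).1
    have h00 : (0 : Site d) 0 = 0 := rfl
    have hle : ∀ i ≤ m, ω i 0 ≤ ω m 0 := by
      intro i hi
      rcases Nat.eq_zero_or_pos i with rfl | hpos
      · rcases Nat.eq_zero_or_pos m with rfl | hm
        · exact le_rfl
        · exact (hωb m hm le_rfl).1.le
      · exact (hωb i hpos hi).2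
    have hm0 : 0 ≤ ω m 0 := by have := hle 0 (Nat.zero_le m); rwa [hω0] at this
    have hυn : 0 ≤ υ n 0 := by
      rcases Nat.eq_zero_or_pos n with rfl | hn
      · rw [hυ0, h00]
      · have := (hυb n hn le_rfl).1
        rw [hυ0, h00] at this
        exact this.le
    have hgt : ∀ j, 1 ≤ j → j ≤ n → ω m 0 < (ω m + υ j) 0 := by
      intro j h1 h2
      have := (hυb j h1 h2).1
      rw [hυ0, h00] at this
      simp only [Pi.add_apply]
      linarith
    refine ⟨concatWalk_mem_saws hω hυ fun i hi j h1 h2 heq => ?_, ?_⟩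
    · have ha := hle i hi
      have hb := hgt j h1 h2
      rw [← heq] at hb
      linarith
    · intro i h1 h2
      have hstart : concatWalk m ω υ 0 = 0 := by simp [concatWalk, hω0]
      have hlast : concatWalk m ω υ (m + n) 0 = ω m 0 + υ n 0 := by
        by_cases h : m + n ≤ m
        · have hn : n = 0 := by omega
          subst hn
          simp [concatWalk, hυ0]
        · simp [concatWalk, h]
      rw [hstart, hlast, h00]
      by_cases h : i ≤ m
      · simp only [concatWalk, if_pos h]
        have := (hωb i h1 h).1
        rw [hω0, h00] at this
        exact ⟨this, (hle i h).trans (by linarith)⟩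
      · simp only [concatWalk, if_neg h, Pi.add_apply]
        have := hυb (i - m) (by omega) (by omega)
        rw [hυ0, h00] at this
        exact ⟨by linarith [this.1], by linarith [this.2]⟩
  · rintro ⟨ω, υ⟩ hp ⟨ω', υ'⟩ hp' h
    simp only [Finset.mem_coe, Finset.mem_product, mem_bridges] at hp hp'
    dsimp only at h
    have hω := mem_saws.1 hp.1.1
    have hυ := mem_saws.1 hp.2.1
    have hω' := mem_saws.1 hp'.1.1
    have hυ' := mem_saws.1 hp'.2.1
    have h1 : ω = ω' := by
      funext i
      rcases le_or_gt i m with hi | hi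
      · have := congrFun h i
        simpa [concatWalk, hi] using this
      · rw [hω.2.1 i hi.le, hω'.2.1 i hi.le]
        have := congrFun h m
        simpa [concatWalk] using this
    subst h1
    simp only [Prod.mk.injEq, true_and]
    funext j
    rcases Nat.eq_zero_or_pos j with rfl | hj
    · rw [hυ.1, hυ'.1]
    · have := congrFun h (m + j)
      simpa [concatWalk, Nat.not_le.2 (by omega : m < m + j)] using this

end Bridges

/-! ### Cutting a walk at the last minimum of its first coordinate:
`c_n ≤ Σ_{m=0}^{n} h_{m+1} h_{n-m}` (Madras–Slade, proof of Theorem 3.1.1, first line of (3.1.7)) -/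

section Decomposition

variable {d : ℕ} [NeZero d]

/-- The minimum of the first coordinate over times `0, …, n`. [cite: MadrasSlade1993, §3.1] -/
def firstMin (n : ℕ) (ω : ℕ → Site d) : ℤ :=
  (Finset.range (n + 1)).inf' ⟨0, by simp⟩ fun i => ω i 0

/-- The last time in `[0, n]` at which the first coordinate is minimal ("let `m` be the largest
`i` such that `ω₁(i) = M`"). [cite: MadrasSlade1993, §3.1, proof of Theorem 3.1.1] -/
def lastMin (n : ℕ) (ω : ℕ → Site d) : ℕ :=
  Nat.findGreatest (fun i => ω i 0 = firstMin n ω) n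

/-- The minimum is a lower bound. [folklore] -/
theorem firstMin_le {n : ℕ} {ω : ℕ → Site d} {i : ℕ} (hi : i ≤ n) : firstMin n ω ≤ ω i 0 :=
  Finset.inf'_le (fun i => ω i 0) (by simpa [Nat.lt_succ_iff] using hi)

/-- The minimum is attained. [folklore] -/
theorem exists_eq_firstMin (n : ℕ) (ω : ℕ → Site d) : ∃ i ≤ n, ω i 0 = firstMin n ω := by
  obtain ⟨i, hi, h⟩ := Finset.exists_mem_eq_inf' (s := Finset.range (n + 1)) ⟨0, by simp⟩
    (fun i => ω i 0)
  exact ⟨i, by simpa [Nat.lt_succ_iff] using hi, h.symm⟩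

/-- `lastMin n ω ≤ n`. [folklore] -/
theorem lastMin_le (n : ℕ) (ω : ℕ → Site d) : lastMin n ω ≤ n :=
  Nat.findGreatest_le n

/-- The first coordinate is minimal at `lastMin`. [folklore] -/
theorem apply_lastMin (n : ℕ) (ω : ℕ → Site d) : ω (lastMin n ω) 0 = firstMin n ω := by
  obtain ⟨i, hi, h⟩ := exists_eq_firstMin n ω
  exact Nat.findGreatest_spec (P := fun i => ω i 0 = firstMin n ω) hi h

/-- After the last minimum the first coordinate is strictly larger. [cite: MadrasSlade1993, §3.1] -/
theorem apply_lastMin_lt {n : ℕ} {ω : ℕ → Site d} {i : ℕ} (h1 : lastMin n ω < i) (h2 : i ≤ n) :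
    ω (lastMin n ω) 0 < ω i 0 := by
  rw [apply_lastMin n ω]
  exact lt_of_le_of_ne (firstMin_le h2)
    fun h => Nat.findGreatest_is_greatest (P := fun i => ω i 0 = firstMin n ω) h1 h2 h.symm

/-- The first coordinate at `lastMin` is the minimum over `[0, n]`. [folklore] -/
theorem apply_lastMin_le {n : ℕ} {ω : ℕ → Site d} {i : ℕ} (h2 : i ≤ n) :
    ω (lastMin n ω) 0 ≤ ω i 0 := by
  rw [apply_lastMin n ω]
  exact firstMin_le h2

/-- The part of `ω` after the last minimum `m` of the first coordinate, translated to start at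
`0`: an `(n-m)`-step half-space walk. [cite: MadrasSlade1993, §3.1, proof of Theorem 3.1.1] -/
def tailWalk (n : ℕ) (ω : ℕ → Site d) : ℕ → Site d :=
  fun i => ω (lastMin n ω + min i (n - lastMin n ω)) - ω (lastMin n ω)

/-- The part of `ω` up to the last minimum `m` of the first coordinate, reversed, preceded by one
step in the direction `-e₁` and translated to start at `0`:
`(ω(m) - e₁, ω(m), ω(m-1), …, ω(0)) + (e₁ - ω(m))`, an `(m+1)`-step half-space walk.
[cite: MadrasSlade1993, §3.1, proof of Theorem 3.1.1] -/
def headWalk (n : ℕ) (ω : ℕ → Site d) : ℕ → Site d :=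
  fun i => if i = 0 then 0 else
    ω (lastMin n ω + 1 - min i (lastMin n ω + 1)) - ω (lastMin n ω) + Pi.single 0 1

/-- Values of `tailWalk`. [folklore] -/
theorem tailWalk_apply {n m : ℕ} {ω : ℕ → Site d} (hm : lastMin n ω = m) (i : ℕ) :
    tailWalk n ω i = ω (m + min i (n - m)) - ω m := by
  simp only [tailWalk, hm]

/-- Values of `headWalk`. [folklore] -/
theorem headWalk_apply {n m : ℕ} {ω : ℕ → Site d} (hm : lastMin n ω = m) (i : ℕ) :
    headWalk n ω i =
      if i = 0 then 0 else ω (m + 1 - min i (m + 1)) - ω m + Pi.single 0 1 := by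
  simp only [headWalk, hm]

/-- The tail piece is a half-space walk. [cite: MadrasSlade1993, §3.1, proof of Theorem 3.1.1] -/
theorem tailWalk_mem {n : ℕ} {ω : ℕ → Site d} (hω : ω ∈ saws d n) :
    tailWalk n ω ∈ halfSpaceWalks d (n - lastMin n ω) := by
  obtain ⟨h0, hend, hadj, hinj⟩ := mem_saws.1 hω
  obtain ⟨m, hm⟩ : ∃ m, lastMin n ω = m := ⟨_, rfl⟩
  have hmn : m ≤ n := hm ▸ lastMin_le n ω
  have hlt : ∀ i, m < i → i ≤ n → ω m 0 < ω i 0 := fun i h1 h2 => by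
    subst hm
    exact apply_lastMin_lt h1 h2
  rw [hm]
  refine mem_halfSpaceWalks.2 ⟨mem_saws.2 ⟨?_, ?_, ?_, ?_⟩, ?_⟩
  · rw [tailWalk_apply hm]
    simp
  · intro i hi
    rw [tailWalk_apply hm, tailWalk_apply hm, min_eq_right hi, min_self]
  · intro i hi
    rw [tailWalk_apply hm, tailWalk_apply hm, min_eq_left hi.le,
      min_eq_left (by omega : i + 1 ≤ n - m), zdGraph_adj_sub_right, ← add_assoc]
    exact hadj (m + i) (by omega)
  · intro i hi j hj hij
    simp only [Set.mem_setOf_eq] at hi hj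
    rw [tailWalk_apply hm, tailWalk_apply hm, min_eq_left hi, min_eq_left hj, sub_left_inj] at hij
    have := hinj (by simp only [Set.mem_setOf_eq]; omega)
      (by simp only [Set.mem_setOf_eq]; omega) hij
    omega
  · intro i h1 h2
    rw [tailWalk_apply hm, tailWalk_apply hm, Nat.zero_min, add_zero, sub_self, min_eq_left h2,
      Pi.sub_apply, Pi.zero_apply, sub_pos]
    exact hlt (m + i) (by omega) (by omega)

/-- The head piece is a half-space walk. [cite: MadrasSlade1993, §3.1, proof of Theorem 3.1.1] -/
theorem headWalk_mem {n : ℕ} {ω : ℕ → Site d} (hω : ω ∈ saws d n) :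
    headWalk n ω ∈ halfSpaceWalks d (lastMin n ω + 1) := by
  obtain ⟨h0, hend, hadj, hinj⟩ := mem_saws.1 hω
  obtain ⟨m, hm⟩ : ∃ m, lastMin n ω = m := ⟨_, rfl⟩
  have hmn : m ≤ n := hm ▸ lastMin_le n ω
  have hle : ∀ i ≤ n, ω m 0 ≤ ω i 0 := fun i hi => by
    subst hm
    exact apply_lastMin_le hi
  rw [hm]
  have hpos : ∀ i, 1 ≤ i → 1 ≤ headWalk n ω i 0 := by
    intro i hi
    rw [headWalk_apply hm, if_neg (by omega)]
    simp only [Pi.add_apply, Pi.sub_apply, Pi.single_eq_same]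
    have := hle (m + 1 - min i (m + 1)) (by omega)
    linarith
  have hz : headWalk n ω 0 = 0 := by rw [headWalk_apply hm, if_pos rfl]
  refine mem_halfSpaceWalks.2 ⟨mem_saws.2 ⟨hz, ?_, ?_, ?_⟩, ?_⟩
  · intro i hi
    rw [headWalk_apply hm, headWalk_apply hm, if_neg (by omega), if_neg (by omega),
      min_eq_right hi, min_self]
  · intro i hi
    rcases Nat.eq_zero_or_pos i with rfl | hipos
    · rw [hz, headWalk_apply hm, if_neg (by omega), zero_add,
        min_eq_left (by omega : 1 ≤ m + 1), Nat.add_sub_cancel, sub_self, zero_add,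
        zdGraph_adj_iff_sub]
      exact ⟨0, Or.inl (by simp)⟩
    · rw [headWalk_apply hm, headWalk_apply hm, if_neg (by omega), if_neg (by omega),
        min_eq_left (by omega : i ≤ m + 1), min_eq_left (by omega : i + 1 ≤ m + 1),
        zdGraph_adj_add_right, zdGraph_adj_sub_right,
        show m + 1 - i = (m + 1 - (i + 1)) + 1 by omega]
      exact (hadj (m + 1 - (i + 1)) (by omega)).symm
  · intro i hi j hj hij
    simp only [Set.mem_setOf_eq] at hi hj
    rcases Nat.eq_zero_or_pos i with rfl | hipos <;> rcases Nat.eq_zero_or_pos j with rfl | hjpos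
    · rfl
    · exfalso
      have h1 := hpos j hjpos
      rw [← hij, hz] at h1
      simp at h1
    · exfalso
      have h1 := hpos i hipos
      rw [hij, hz] at h1
      simp at h1
    · rw [headWalk_apply hm, headWalk_apply hm, if_neg (by omega), if_neg (by omega),
        min_eq_left (by omega : i ≤ m + 1), min_eq_left (by omega : j ≤ m + 1),
        add_left_inj, sub_left_inj] at hij
      have := hinj (by simp only [Set.mem_setOf_eq]; omega)
        (by simp only [Set.mem_setOf_eq]; omega) hij
      omega
  · intro i h1 h2
    have := hpos i h1
    rw [hz, Pi.zero_apply]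
    linarith

/-- **`c_n ≤ Σ_{m=0}^{n} h_{m+1} · h_{n-m}`**: cut an `n`-step self-avoiding walk at the last
minimum `m` of its first coordinate; the piece after `m` is a half-space walk, and the piece up to
`m`, reversed and preceded by a step `-e₁`, is a half-space walk; `ω` is recovered from the two
pieces and `m`. [cite: MadrasSlade1993, §3.1, eq. (3.1.7)] -/
theorem count_le_sum_halfSpaceCount (n : ℕ) :
    count d n ≤
      ∑ m ∈ Finset.range (n + 1), halfSpaceCount d (m + 1) * halfSpaceCount d (n - m) := by
  classical
  have hcard : ((Finset.range (n + 1)).sigma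
      fun m => halfSpaceWalks d (m + 1) ×ˢ halfSpaceWalks d (n - m)).card =
      ∑ m ∈ Finset.range (n + 1), halfSpaceCount d (m + 1) * halfSpaceCount d (n - m) := by
    rw [Finset.card_sigma]
    simp_rw [Finset.card_product]
    rfl
  rw [← card_saws, ← hcard]
  refine Finset.card_le_card_of_injOn
    (fun ω => (⟨lastMin n ω, (headWalk n ω, tailWalk n ω)⟩ :
      Σ _ : ℕ, (ℕ → Site d) × (ℕ → Site d))) ?_ ?_
  · intro ω hω
    rw [Finset.mem_coe] at hω
    rw [Finset.mem_coe, Finset.mem_sigma, Finset.mem_range, Finset.mem_product]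
    exact ⟨Nat.lt_succ_of_le (lastMin_le n ω), headWalk_mem hω, tailWalk_mem hω⟩
  · intro ω hω ω' hω' h
    rw [Finset.mem_coe] at hω hω'
    simp only [Sigma.mk.inj_iff] at h
    obtain ⟨hmm, h⟩ := h
    have h' : (headWalk n ω, tailWalk n ω) = (headWalk n ω', tailWalk n ω') := eq_of_heq h
    simp only [Prod.mk.injEq] at h'
    obtain ⟨hh, ht⟩ := h'
    obtain ⟨h0, hend, hadj, hinj⟩ := mem_saws.1 hω
    obtain ⟨h0', hend', hadj', hinj'⟩ := mem_saws.1 hω'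
    obtain ⟨m, hm⟩ : ∃ m, lastMin n ω = m := ⟨_, rfl⟩
    have hm' : lastMin n ω' = m := hmm.symm.trans hm
    have hmn : m ≤ n := hm ▸ lastMin_le n ω
    -- recover `ω m` from the last vertex of the head piece
    have hωm : ω m = ω' m := by
      have := congrFun hh (m + 1)
      rw [headWalk_apply hm, headWalk_apply hm', if_neg (by omega), if_neg (by omega), min_self,
        Nat.sub_self, h0, h0', add_left_inj, zero_sub, zero_sub, neg_inj] at this
      exact this
    funext i
    rcases le_or_gt i m with hi | hi
    · rcases Nat.eq_zero_or_pos (m - i) with h | h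
      · have : i = m := by omega
        rw [this, hωm]
      · have := congrFun hh (m + 1 - i)
        rw [headWalk_apply hm, headWalk_apply hm', if_neg (by omega), if_neg (by omega),
          min_eq_left (by omega : m + 1 - i ≤ m + 1), show m + 1 - (m + 1 - i) = i by omega,
          hωm, add_left_inj, sub_left_inj] at this
        exact this
    · rcases le_or_gt i n with hin | hin
      · have := congrFun ht (i - m)
        rw [tailWalk_apply hm, tailWalk_apply hm', min_eq_left (by omega : i - m ≤ n - m),
          show m + (i - m) = i by omega, hωm, sub_left_inj] at this
        exact this
      · have := congrFun ht (n - m)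
        rw [tailWalk_apply hm, tailWalk_apply hm', min_self, show m + (n - m) = n by omega, hωm,
          sub_left_inj] at this
        rw [hend i hin.le, hend' i hin.le, this]

end Decomposition

end Literature.Probability.RandomPlanarGeometry.SAW.Zd
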